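import Summits.ABC.ABC.Theses.FeketeScales
import Literature.NumberTheory.DiophantineGeometry.AbcPrimePowerFamily
import HarnessLib

/-!
# Route FeketeScales — crux `SparseGoodScales` (stmt-ABC-2161): the crux forces
# `limsup log rad(q^n − 1) / (n log q) = 1` in every prime base

Helper file (`--supports stmt-ABC-2161`, lead seat c11) for the crux `SparseGoodScales` of route
`FeketeScales`.  The sharpest "Mersenne content" of the crux, isolated as a statement about the
radicals of `q^n − 1` alone (it is the first step of the Wieferich floors of
`FeketeScalesSparseGoodScalesWieferich.lean` / `…WieferichMass.lean`, recorded there only inside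
proofs):

* `sparseGoodScales_large_radical_of_goodScales` — good scales at ONE exponent `1 + δ` (`δ ≥ 0`)
  at arbitrarily large `R` force, for every prime `q`, infinitely many `n` with
  `rad(q^n − 1) > q^{(n−1)/(1+δ) − 1}`: at a good scale `R` the least `n` with `q^n > R^{1+δ}` gives
  a triple `(1, q^n − 1, q^n)` violating `c ≤ R^{1+δ}`, so its radical `q · rad(q^n − 1)` exceeds
  `R ≥ q^{(n−1)/(1+δ)}`;
* `sparseGoodScales_imp_radical_limsup_one` — hence **`SparseGoodScales` ⟹ for every prime `q` and
  every `ε > 0`, `rad(q^n − 1) ≥ q^{(1−ε)n}` for infinitely many `n`**, i.e.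
  `limsup_n log rad(q^n − 1)/(n log q) = 1` (registered sub-goal).

Reading.  abc gives `lim = 1`.  Unconditionally not even `limsup > 0` is known (the best lower
bounds for `rad(2^n − 1)` are of the shape `n^{1+o(1)}`, via the largest prime factor, Stewart
2013); `limsup = 1` at `q` implies the infinitude of non-Wieferich primes to base `q` (if all large
primes were Wieferich, `rad(q^n − 1) ≤ C q^{n/2}`), so this floor sits ABOVE the non-Wieferich floor
of p99695 and is the statement any proof of the crux must in fact deliver about `2^n − 1`.
-/

-- `Summit.<Summit>.<Problem>` is the mandated summit-side namespace (CONVENTIONS §2); for the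
-- single-conjunct summit `ABC` the two coincide, so the duplicate `ABC.ABC` is deliberate.
set_option linter.dupNamespace false

noncomputable section

namespace Summit.ABC.ABC.Theorems

open Literature.NumberTheory.DiophantineGeometry UniqueFactorizationMonoid
open Summit.ABC.ABC.Theses.FeketeScales

/-- **Good scales at one exponent force large radicals of `q^n − 1` infinitely often.**  If
`δ ≥ 0` and there are arbitrarily large scales `R` at which every abc triple of radical `≤ R` has
`c ≤ R^{1+δ}`, then for every prime `q` and every `N` there is `n ≥ N` with
`q^{(n−1)/(1+δ) − 1} < rad(q^n − 1)`.  Proof: at a good scale `R ≥ q^N` let `n` be least with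
`q^n > R^{1+δ}` (so `n > N` and `q^{n−1} ≤ R^{1+δ}`, i.e. `q^{(n−1)/(1+δ)} ≤ R`); the abc triple
`(1, q^n − 1, q^n)` violates `c ≤ R^{1+δ}`, so its radical `q · rad(q^n − 1)` exceeds `R`. [folklore] -/
theorem sparseGoodScales_large_radical_of_goodScales {δ : ℝ} (hδ : 0 ≤ δ)
    (h : ∀ N : ℕ, ∃ R : ℕ, N ≤ R ∧ ∀ a b c : ℕ, IsABCTriple a b c → rad a b c ≤ R →
      (c : ℝ) ≤ (R : ℝ) ^ (1 + δ))
    {q : ℕ} (hq : q.Prime) (N : ℕ) :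
    ∃ n : ℕ, N ≤ n ∧ (q : ℝ) ^ (((n : ℝ) - 1) / (1 + δ) - 1) < ((radical (q ^ n - 1) : ℕ) : ℝ) := by
  have hq1 : (1 : ℝ) < q := by exact_mod_cast hq.one_lt
  have hq0 : (0 : ℝ) < q := by linarith
  have hδ1 : 0 < 1 + δ := by linarith
  obtain ⟨R, hRN, hgood⟩ := h (max (q ^ N) 1)
  have hRqN : q ^ N ≤ R := le_trans (le_max_left _ _) hRN
  have hR1 : 1 ≤ R := le_trans (le_max_right _ _) hRN
  have hR1' : (1 : ℝ) ≤ R := by exact_mod_cast hR1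
  have hR0 : (0 : ℝ) < R := by linarith
  -- `F := ⌊R^{1+δ}⌋ ≥ 1`, `n := log_q F + 1` is the least exponent with `q^n > R^{1+δ}`
  set Y : ℝ := (R : ℝ) ^ (1 + δ) with hY
  have hY1 : (1 : ℝ) ≤ Y := by rw [hY]; exact Real.one_le_rpow hR1' hδ1.le
  have hRY : (R : ℝ) ≤ Y := by
    rw [hY]
    calc (R : ℝ) = (R : ℝ) ^ (1 : ℝ) := (Real.rpow_one _).symm
      _ ≤ (R : ℝ) ^ (1 + δ) := Real.rpow_le_rpow_of_exponent_le hR1' (by linarith)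
  set F : ℕ := ⌊Y⌋₊ with hF
  have hF1 : 1 ≤ F := by rw [hF]; exact Nat.le_floor (by exact_mod_cast hY1)
  have hFY : (F : ℝ) ≤ Y := Nat.floor_le (by linarith)
  have hYF : Y < F + 1 := Nat.lt_floor_add_one Y
  set n : ℕ := Nat.log q F + 1 with hn
  have hn1 : 1 ≤ n := by omega
  have hFlt : F < q ^ n := Nat.lt_pow_succ_log_self hq.one_lt F
  have hqle : q ^ (n - 1) ≤ F := by
    rw [hn, Nat.add_sub_cancel]
    exact Nat.pow_log_le_self q (by omega)
  -- `q^n > Y ≥ R ≥ q^N`, so `n > N`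
  have hqnY : Y < (q : ℝ) ^ n := by
    have : ((F + 1 : ℕ) : ℝ) ≤ ((q ^ n : ℕ) : ℝ) := by exact_mod_cast hFlt
    push_cast at this
    linarith
  have hNn : N ≤ n := by
    have h1 : (q : ℝ) ^ N < (q : ℝ) ^ n := by
      have : ((q ^ N : ℕ) : ℝ) ≤ (R : ℝ) := by exact_mod_cast hRqN
      push_cast at this
      linarith
    have h2 : q ^ N < q ^ n := by exact_mod_cast h1
    exact le_of_lt ((Nat.pow_lt_pow_iff_right hq.one_lt).mp h2)
  refine ⟨n, hNn, ?_⟩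
  -- the triple `(1, q^n − 1, q^n)` violates goodness, so its radical exceeds `R`
  have htri : IsABCTriple 1 (q ^ n - 1) (q ^ n) := isABCTriple_one_pow_sub_one hq.two_le hn1
  have hradgt : R < rad 1 (q ^ n - 1) (q ^ n) := by
    by_contra hle
    have hc := hgood 1 (q ^ n - 1) (q ^ n) htri (le_of_not_gt hle)
    push_cast at hc
    linarith
  have hradgt' : (R : ℝ) < ((radical (q ^ n - 1) : ℕ) : ℝ) * q := by
    have : ((R : ℕ) : ℝ) < ((rad 1 (q ^ n - 1) (q ^ n) : ℕ) : ℝ) := by exact_mod_cast hradgt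
    rw [rad_one_pow_sub_one_pow hq hn1] at this
    push_cast at this
    exact this
  -- `q^{(n−1)/(1+δ)} ≤ R`: from `q^{n−1} ≤ F ≤ Y = R^{1+δ}`
  have hpowle : (q : ℝ) ^ (((n : ℝ) - 1) / (1 + δ)) ≤ R := by
    have h1 : ((q ^ (n - 1) : ℕ) : ℝ) ≤ Y := le_trans (by exact_mod_cast hqle) hFY
    have h2 : ((q ^ (n - 1) : ℕ) : ℝ) = (q : ℝ) ^ ((n : ℝ) - 1) := by
      have : ((n - 1 : ℕ) : ℝ) = (n : ℝ) - 1 := by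
        rw [Nat.cast_sub hn1]; push_cast; ring
      push_cast
      rw [← this, Real.rpow_natCast]
    rw [h2, hY] at h1
    -- take the `1/(1+δ)`-th power
    have h3 : ((q : ℝ) ^ ((n : ℝ) - 1)) ^ (1 / (1 + δ)) ≤ ((R : ℝ) ^ (1 + δ)) ^ (1 / (1 + δ)) :=
      Real.rpow_le_rpow (by positivity) h1 (by positivity)
    rw [← Real.rpow_mul hq0.le, ← Real.rpow_mul hR0.le] at h3
    have e1 : ((n : ℝ) - 1) * (1 / (1 + δ)) = ((n : ℝ) - 1) / (1 + δ) := by ring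
    have e2 : (1 + δ) * (1 / (1 + δ)) = 1 := by field_simp
    rw [e1, e2, Real.rpow_one] at h3
    exact h3
  -- combine: `q^{(n−1)/(1+δ) − 1} = q^{(n−1)/(1+δ)} / q ≤ R / q < rad(q^n − 1)`
  have hsplit : (q : ℝ) ^ (((n : ℝ) - 1) / (1 + δ) - 1) =
      (q : ℝ) ^ (((n : ℝ) - 1) / (1 + δ)) / q := by
    rw [Real.rpow_sub hq0, Real.rpow_one]
  rw [hsplit, div_lt_iff₀ hq0]
  linarith

/-- **The crux forces `limsup log rad(q^n − 1)/(n log q) = 1` in every prime base.**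
`SparseGoodScales` (stmt-ABC-2161) implies that for every prime `q`, every `ε > 0` and every `N`
there is `n ≥ N` with `q^{(1−ε)n} ≤ rad(q^n − 1)` (use the good scales of exponent `1 + ε/2` and
`(n−1)/(1+ε/2) − 1 ≥ (1−ε)n` for `n ≥ 4/ε`).  abc gives the limit `1`; unconditionally not even
`limsup > 0` is known, and `limsup = 1` already implies the infinitude of non-Wieferich primes to
base `q`.  (The statement is kept on one line: it is the signature registered on stmt-ABC-2161 for
this sub-goal.) [folklore] -/
theorem sparseGoodScales_imp_radical_limsup_one : Summit.ABC.ABC.Theses.FeketeScales.SparseGoodScales → ∀ q : ℕ, q.Prime → ∀ ε : ℝ, 0 < ε → ∀ N : ℕ, ∃ n : ℕ, N ≤ n ∧ (q : ℝ) ^ ((1 - ε) * n) ≤ ((UniqueFactorizationMonoid.radical (q ^ n - 1) : ℕ) : ℝ) := by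
  intro h q hq ε hε N
  have hq1 : (1 : ℝ) < q := by exact_mod_cast hq.one_lt
  set δ : ℝ := ε / 2 with hδ
  have hδ0 : 0 ≤ δ := by rw [hδ]; linarith
  obtain ⟨N₁, hN₁⟩ := exists_nat_gt (4 / ε)
  obtain ⟨n, hn, hrad⟩ :=
    sparseGoodScales_large_radical_of_goodScales hδ0 (h δ (by rw [hδ]; linarith)) hq (max N N₁)
  have hNn : N ≤ n := le_trans (le_max_left _ _) hn
  have hN₁n : N₁ ≤ n := le_trans (le_max_right _ _) hn
  refine ⟨n, hNn, ?_⟩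
  -- `(1 − ε) n ≤ (n − 1)/(1 + δ) − 1` for `n ≥ 4/ε`
  have hεn : 4 < ε * n := by
    have h1 : 4 / ε < n := lt_of_lt_of_le hN₁ (by exact_mod_cast hN₁n)
    rw [div_lt_iff₀ hε] at h1
    linarith
  have hδ1 : 0 < 1 + δ := by linarith
  have hexp : (1 - ε) * n ≤ ((n : ℝ) - 1) / (1 + δ) - 1 := by
    rw [le_sub_iff_add_le, le_div_iff₀ hδ1, hδ]
    have hn0 : (0 : ℝ) ≤ n := by positivity
    nlinarith
  exact le_trans (Real.rpow_le_rpow_of_exponent_le hq1.le hexp) hrad.le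

end Summit.ABC.ABC.Theorems

end
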